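import Summits.QuantumFields.YangMills.Theorems.BalabanUVNodesN17AtSpineCarriers
import Summits.QuantumFields.YangMills.Theorems.BalabanUVNodesSpineRatesHolder
import Summits.QuantumFields.YangMills.Theorems.BalabanUVNodesN27ReadOutAtU3OfKernels
import Summits.QuantumFields.YangMills.Theorems.BalabanUVNodesN22AtU3OfKernels
import Literature.MathematicalPhysics.QuantumFieldTheory.Balaban1983to89.T4BetaStationary
import Literature.MathematicalPhysics.QuantumFieldTheory.Balaban1983to89.Node00.Record13SepCoPH

/-!
# BalabanUVNodes ∕ node N17 = NE4 = node U2's input — THE SECOND COMPONENT OF NODE U2's INPUT TRIPLE (the HISTORY MODULI `HistLipschitz`)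
# AT THE STAGE-13 RECORD, AND ITS K2⁷ LINE-2 CONSUMER S3 `stub_cont13 : ContRecord13` (β-CONTINUITY ON THE BOXES)

Cell `pub-ymgap` (HUMAN RULINGS D-0062 ∕ D-0149), WIDTH SEAT `pub-ymgap-dag-n17-w3` (seat 3 of 3 on NODE n17), generation 2; W-SEAT-START-LIST v8
§0 (iii) (the §n17 list is exhausted; this is the successor piece the seat named on the bus, CLAIM-1 ∕ INTENT-1).  THEOREMS ONLY (0 `def`, 0 `instance`,
0 `notation`, 0 `sorry`); filed `--kind proof --supports stmt-QuantumFields-20544 --as helper` (K3⁷ `SpineGivenEndpointR13SepCoPH`); the K2⁷ item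
`EndpointGivenBR13SepCoPH` (stmt-QuantumFields-20543) is served BY NAME through its line-2 stub S3.  COUNT-NEUTRAL.

THE POINT.  Node U2's input on the data is the TRIPLE `Spine.NE4.U2Inputs D c C ρ γ Λ = ScaleShiftRate c ρ γ D.βfun ∧ HistLipschitz Λ γ D.βfun ∧
FadingMemory C ρ Λ` (`Spine/NE4/Targets`).  Its FIRST conjunct is node N17 = NE4 proper; the route's K4 cluster derives it at node U3's carriers from the
β-read-out binders (D4) and N18 = NE5 — dag-n17-a's `YMDAG.N17.n17At_of_readOutAt` («(D4) ∧ N18 ⇒ N17, N22 IDLE»).  THIS FILE is the MIRROR statement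
for the SECOND conjunct: **(D4) ∧ N22 ⇒ `HistLipschitz (k i ↦ cr·Λ(k+1) i) γ D.βfun`, N18 IDLE** (indeed only the window clause, `RepresentsA`, the
run-A slice membership and the read-out bound `ReadBoundedOn` of (D4) and the NE9 half of N22 are read — `T4BetaReadOutLipschitz.histLipschitz_of_ne9_on`
BY NAME), and hence, by `T4BetaStationary.betaContH_of_histLipschitz`, **`FlowStep.BetaContH γ D.βfun`** — joint continuity of every `β_{k+1}` on the box
`]0, γ]^{k+1}`.

WHY IT MATTERS (located, for the K2⁷ planner ∕ CRIT-2; no text change asked).  K2⁷ v3∕v4 LINE 2 «shift-cauchy-everyslope» has four registered stubs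
`stub_d1ResiduePos13`, `stub_n17AtRecord13`, `stub_anchor13`, `stub_cont13`; the last is S3 `ContRecord13 := ∀ admissible ⁷ tuple, BetaContH θ.γ β₁₃`
(«M per k»; «T4 side `betaContH_of_histLipschitz`»).  §2 shows that S3's body FOLLOWS, tuple by tuple, from the SAME node-U3 slots that K3⁷'s rates
predicate `PHolderD4 β` carries — (D4) and N22 at a bundle with window radius `θ.γ` — exactly as `stub_n17AtRecord13`'s body follows from (D4) and N18
(dag-n17-w1 `…N17AtRecord13SharedStub` §2).  So TWO of line 2's four stubs are K3⁷-K4-DERIVED at node U3; line 2's K2-proper content is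
`stub_d1ResiduePos13 ∧ stub_anchor13`; and the CORRELATED-FAILURE located by CRIT-2 for N17 extends to S3: if (D4) fails at the record, N17 AND S3 lose
their producer road together (S3 keeps the chain road of dag-n26-a `…N26BetaContRecord` §3, N17 keeps nothing).  §2's `n17Body_and_contBody_of_readOut_n18_n22`
says it in one sentence: ONE node-U3 witness per admissible tuple carrying `u.γ = θ.γ`, `0 ≤ u.ρ < 1`, (D4), N18, N22 inhabits BOTH stub bodies.

WHAT IS KERNEL-CHECKED (compositions of tree theorems BY NAME; nothing restated):
* §1 AT THE CARRIERS (`N`-generic, any `D : Datum F N`, any `u : U3Carriers`): `histLipschitz_of_readOutAt_ne9` · `histLipschitz_of_readOutAt_n22` ·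
  `betaContH_of_readOutAt_ne9` · ★ `betaContH_of_readOutAt_n22` · `betaContH_of_u2Inputs` (the triple carries (C)) · `betaContH_of_ratesAt_readOutAt`
  (β = 1 currency) · `betaContH_of_pHolderD4_body` (K3⁷ v3's `PHolderD4 β D R` body SPELLED ⇒ `BetaContH R.u3.γ D.βfun`; N14∕N15∕N16∕N17∕N18 and the
  ρ-letter idle).
* §2 AT NODE 00's ⁷ RECORD: `betaContH_betaOfRecord₁₃_of_readOutAt_n22_coPH` ∕ `…_of_readOutAt_n22` (def-T's `betaOfRecord₁₃` currency, `CoPH` ∕ `SepCoPH`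
  keys) · `betaContH_merged_of_readOutAt_n22` (the canonical-version merged-β currency of the K2⁷ skeleton, by def-T's
  `βfun_datumOfRecord₁₃SepCoPH_eq_betaOfRecord₈Tχ`) · ★★ `contRecord13Body_of_readOut_n22` (`N = 2`: K2⁷ v3∕v4's `ContRecord13` BODY LITERALLY from «∀
  admissible ⁷ tuple, ∃ u, u.γ = θ.γ ∧ ReadOutAt … u ∧ N22At u») · ★ `n17Body_and_contBody_of_readOut_n18_n22` (one witness, both line-2 bodies).
* §2b NODE N26's LITERAL (binder B4 «∃ γc > 0, BetaContH γc D.βfun») from the same two slots: `n26lit_of_readOutAt_n22` · `n26lit_datumOfRecord₁₃SepCoPH_of_readOutAt_n22`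
  (θ admissible ⇒ `0 < θ.γ`; dag-n26-c's adapter shape) — the DAG node N26 at the record has a node-U2 road besides its (D4)-chain road, both (D4)-dependent.
* §3 JUNCTION WITH K3⁷ v3's STUB 1 (guarded restriction; cf. dag-n17-w1's §3 for N17): `betaContH_guarded_of_keyedRatesHolderD4_ofRecord` (v3's
  `KeyedRatesHolderD4 β (rrOfRecord 𝔯 ksel)` body SPELLED at `rateCarriersOfRecord₁₃CoPH 𝔯 … (ksel …)`, any tuple guard `Rg` ⇒ the S3 body on the `Rg`
  tuples) · `contRecord13Body_guarded_of_keyedRatesHolderD4_ofRecord` (`N = 2`, merged currency).  HONEST: K3⁷'s stub 1 serves `stub_cont13` ONLY on the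
  guarded tuples (`θ.ZhUnity F 2 ∧ θ.SlotsNondegenerate₁₃ F 2` in the skeleton of record); the guard-free remainder is K2's own.
* §4 UNDER K3⁷ v3's NODE-U3 PIN (kernel currency; dag-n27-w1 `readOutAt_objectsOfRecord₁₃_coPH`, dag-n22-w3 `n22At_u3OfRecord₁₃_objectsOfRecord₁₃_iff`
  BY NAME): ★ `betaContH_betaOfRecord₁₃_of_kernels` (letters `ℓ : U3Letters₁₁` with `ℓ.Signs`, `0 < ℓ.κ`, `betaPrime510 4 1 ℓ.κ ≤ ℓ.cr`, the (5.10) clause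
  of record `KernelDecayOfRecord₁₃ F N θ 0 1 ℓ.κ` and NE9 of the KERNEL FUNCTIONAL OF RECORD on the window ⇒ `BetaContH θ.γ (betaOfRecord₁₃ …)` — NO N18,
  NO NE5) · `betaContH_of_kernels_pin_n22At` (the `hpin` form of v3's `U3PinnedKernels`, N22 taken AT THE PINNED BUNDLE as stub 1 delivers it) ·
  `contRecord13Body_of_kernels` (`N = 2`: S3 under a letter reading `ℓ` costs EXACTLY {Signs, 0 < κ, betaPrime ≤ cr, (5.10) of record, windowed NE9 of the
  kernel functional of record} — the N22 + (D4) rows of stub 1's bill and nothing else).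

HONEST FRAMING.  Count-neutral helper; elementary bookkeeping BY NAME over typed SHAPES (a history-Lipschitz family is continuous on the boxes); every
antecedent — NE9 for Bałaban's functional, its windowed kernel form, the (5.10) decay of the limiting (1.21) kernels of the merged term of record, the (D4)
read-out binders — is a HYPOTHESIS inhabited for no family here; NE9 is NOT PRINTED for d = 4 ([Balaban1987RG1] p. 298 says only that β_j «depends also
on all preceding coupling constants»; p. 264's smoothness clause is about the LAST coupling) and NOT proved; `stub_cont13` ∕ `stub_n17AtRecord13` ∕
`stub_rates13H` NOT proved; N17 ∕ N22 ∕ N26 NOT discharged; K2⁷ ∕ K3⁷ OPEN, NOT claimed; counts UNMOVED (typed 28∕28 · discharged 5∕27 (A 5∕28)); one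
finite 𝕋⁴ programme at fixed ε — R4 closes the conditional rung `BalabanLadder.UV` only; the Yang–Mills mass gap (Clay) is NOT proved by any of this —
nothing continuum ∕ ℝ⁴ ∕ OS ∕ mass gap ∕ Clay.
References (locators only): [Balaban1987RG1] = T. Bałaban, CMP **109** (1987): (1.20)–(1.22) p. 264, §5 p. 298, (5.10) p. 293.
-/

noncomputable section

open scoped Matrix.Norms.L2Operator

namespace YMDAG.N17.HistModuliCont

open Literature.MathematicalPhysics.QuantumFieldTheory.Balaban1983to89
open Literature.MathematicalPhysics.QuantumFieldTheory.Balaban1983to89.FlowStep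
open Literature.MathematicalPhysics.QuantumFieldTheory.Balaban1983to89.T4CouplingMatching (HistLipschitz)
open Literature.MathematicalPhysics.QuantumFieldTheory.Balaban1983to89.T4Continuum (T4Family ULoop)
open Literature.MathematicalPhysics.QuantumFieldTheory.Balaban1983to89.T4OutputRate (Window NE9)
open Literature.MathematicalPhysics.QuantumFieldTheory.Balaban1983to89.T4BetaReadOutLipschitz (histLipschitz_of_ne9_on)
open Literature.MathematicalPhysics.QuantumFieldTheory.Balaban1983to89.T4BetaStationary (betaContH_of_histLipschitz)
open Literature.MathematicalPhysics.QuantumFieldTheory.Balaban1983to89.B12Sec2to5 (betaPrime510)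
open Literature.MathematicalPhysics.QuantumFieldTheory.Balaban1983to89.Node00
open Literature.MathematicalPhysics.QuantumFieldTheory.Balaban1983to89.Node00.U3OfKernels (objectsOfRecord₁₃ KernelDecayOfRecord₁₃)
open Summit.QuantumFields.BalabanUV.T4Continuum.Spine.NE4 (U2Inputs)
open YMDAG.UVSplit
open Summit.QuantumFields.YangMills.BalabanUVNodes.SpineRatesHolder (RatesHolderAt)
open Summit.QuantumFields.YangMills.BalabanUVNodes.N27ReadOutAtU3OfKernels (readOutAt_objectsOfRecord₁₃_coPH)
open YMDAG.N22.AtKernels (n22At_u3OfRecord₁₃_objectsOfRecord₁₃_iff)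

variable {N : ℕ} [NeZero N]

/-! ## §1 AT THE CARRIERS: (D4) ∧ N22 ⇒ node U2's history moduli ⇒ β-continuity on the boxes (N18 idle) -/

section Carriers

variable {F : T4Family}

/-- **NODE U2's SECOND INPUT AT THE CARRIERS ⇐ (D4) ∧ NE9 — N18 IDLE (kernel, by name).**  From `ReadOutAt D u` only the window clause, run A's
`RepresentsA`, the run-A slice membership and the read-out bound `ReadBoundedOn … u.κ u.cr` are used (run B's `RepresentsB`, the covariance and every
letter sign are idle), together with NE9 for run A's functional: `T4BetaReadOutLipschitz.histLipschitz_of_ne9_on`.  The history moduli of `D.βfun` are the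
carriers' `Λ` read through the read-out constant: `Λβ k i = u.cr · u.Λ (k+1) i`.  Rows NE9 and (D4) UNPRINTED — binders. [cite: Balaban1987RG1, §5 p.298] -/
theorem histLipschitz_of_readOutAt_ne9 (D : Datum F N) {u : U3Carriers} (hD4 : ReadOutAt D u) (h9 : NE9 u.EA u.W u.κ u.Λ) :
    HistLipschitz (fun k i => u.cr * u.Λ (k + 1) i) u.γ D.βfun := by
  obtain ⟨𝒜A, _, rA, _, hW, hA, -, h𝒜A, -, hr, -⟩ := hD4
  exact histLipschitz_of_ne9_on hW h9 hA h𝒜A hr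

/-- **… FROM THE N22 SLOT** (`N22At u = NE9 … ∧ FadingMemory …`; the fading-memory half is idle for the moduli themselves — it only prices them).
[cite: Balaban1987RG1, §5 p.298] -/
theorem histLipschitz_of_readOutAt_n22 (D : Datum F N) {u : U3Carriers} (hD4 : ReadOutAt D u) (h22 : N22At u) :
    HistLipschitz (fun k i => u.cr * u.Λ (k + 1) i) u.γ D.βfun :=
  histLipschitz_of_readOutAt_ne9 D hD4 h22.1

/-- **β-CONTINUITY ON THE BOXES ⇐ (D4) ∧ NE9** (a history-Lipschitz family is continuous on every box `]0, γ]^{k+1}`: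
`T4BetaStationary.betaContH_of_histLipschitz`, no sign condition on the moduli). [folklore] -/
theorem betaContH_of_readOutAt_ne9 (D : Datum F N) {u : U3Carriers} (hD4 : ReadOutAt D u) (h9 : NE9 u.EA u.W u.κ u.Λ) : BetaContH u.γ D.βfun :=
  betaContH_of_histLipschitz (histLipschitz_of_readOutAt_ne9 D hD4 h9)

/-- ★ **β-CONTINUITY ON THE BOXES ⇐ (D4) ∧ N22 — N18 IDLE** (the mirror of dag-n17-a's `n17At_of_readOutAt` «(D4) ∧ N18 ⇒ N17, N22 idle»). [folklore] -/
theorem betaContH_of_readOutAt_n22 (D : Datum F N) {u : U3Carriers} (hD4 : ReadOutAt D u) (h22 : N22At u) : BetaContH u.γ D.βfun :=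
  betaContH_of_readOutAt_ne9 D hD4 h22.1

/-- **NODE U2's WHOLE TRIPLE CARRIES (C)**: `U2Inputs D c C ρ γ Λ → BetaContH γ D.βfun` (its second conjunct; the rate conjuncts idle). [folklore] -/
theorem betaContH_of_u2Inputs (D : Datum F N) {c C ρ γ : ℝ} {Λ : ℕ → ℕ → ℝ} (h : U2Inputs D c C ρ γ Λ) : BetaContH γ D.βfun :=
  betaContH_of_histLipschitz h.2.1

/-- **β = 1 CURRENCY**: K4's per-string conclusion `RatesAt D R` together with the (D4) binders at `R.u3` gives β-continuity on the bundle's window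
(only the N22 conjunct of `RatesAt` is read). [folklore] -/
theorem betaContH_of_ratesAt_readOutAt {D : Datum F N} {R : RateCarriers N} (h : RatesAt D R) (hD4 : ReadOutAt D R.u3) : BetaContH R.u3.γ D.βfun :=
  betaContH_of_readOutAt_n22 D hD4 h.2.2.2.2.2

/-- **K3⁷ v3's RATES PREDICATE `PHolderD4 β D R` (body SPELLED: `RatesHolderAt D R β ∧ ReadOutAt D R.u3 ∧ (0 ≤ R.u3.ρ ∧ R.u3.ρ < 1)`) CARRIES
β-CONTINUITY ON THE BUNDLE's WINDOW** — N14 ∕ N15 ∕ N16 ∕ N17 ∕ N18 and the junction letter `ρ` are idle; only (D4) and N22 are read. [folklore] -/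
theorem betaContH_of_pHolderD4_body {D : Datum F N} {R : RateCarriers N} {β : ℝ}
    (h : RatesHolderAt D R β ∧ ReadOutAt D R.u3 ∧ (0 ≤ R.u3.ρ ∧ R.u3.ρ < 1)) : BetaContH R.u3.γ D.βfun :=
  betaContH_of_readOutAt_n22 D h.2.1 h.1.2.2.2.2.2

end Carriers

/-! ## §2 AT NODE 00's STAGE-13 RECORD: the K2⁷ LINE-2 stub S3 `ContRecord13` from the node-U3 slots -/

section Record

variable {F : T4Family}

/-- **AT THE v1.7 `CoPH` DATUM OF RECORD** (def-T `datumOfRecord₁₃CoPH`, β-face `βfun_datumOfRecord₁₃CoPH`, `rfl`): a node-U3 bundle with window radius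
`θ.γ` carrying (D4) and N22 gives `BetaContH θ.γ (betaOfRecord₁₃ F N θ.toStage13Params)`. [folklore] -/
theorem betaContH_betaOfRecord₁₃_of_readOutAt_n22_coPH (θ : Stage13HParams F N) (hP : θ.Provisos₁₃CoPH F N) {u : U3Carriers} (hγ : u.γ = θ.γ)
    (hD4 : ReadOutAt (datumOfRecord₁₃CoPH F N θ hP) u) (h22 : N22At u) : BetaContH θ.γ (betaOfRecord₁₃ F N θ.toStage13Params) := by
  have h := betaContH_of_readOutAt_n22 _ hD4 h22
  rw [βfun_datumOfRecord₁₃CoPH, hγ] at h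
  exact h

/-- **AT THE ⁷ ITEM DATUM `datumOfRecord₁₃SepCoPH F N θ hP`** (= the `CoPH` datum at `hP.toCore`, def-T `datumOfRecord₁₃SepCoPH_eq_coPH`, `rfl`):
(D4) ∧ N22 at a bundle with `u.γ = θ.γ` ⇒ `BetaContH θ.γ (betaOfRecord₁₃ F N θ.toStage13Params)`. [folklore] -/
theorem betaContH_betaOfRecord₁₃_of_readOutAt_n22 (θ : Stage13HParams F N) (hP : θ.Provisos₁₃SepCoPH F N) {u : U3Carriers} (hγ : u.γ = θ.γ)
    (hD4 : ReadOutAt (datumOfRecord₁₃SepCoPH F N θ hP) u) (h22 : N22At u) : BetaContH θ.γ (betaOfRecord₁₃ F N θ.toStage13Params) :=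
  betaContH_betaOfRecord₁₃_of_readOutAt_n22_coPH θ hP.toCore hγ hD4 h22

/-- **THE SAME IN THE K2⁷ SKELETON's CANONICAL-VERSION MERGED-β CURRENCY** `βmTχ(θ) := betaMerged F (mergedTermFamilyMatT F N (TcanOfRecord F N)
(chiFixed29 F N θ.ν θ.ε₂₉) θ.εbg) θ.ρ8 θ.bV`, β of record `betaOfMerged βmTχ (beta0OfMerged βmTχ θ.v₀) θ.γ` (def-T's
`βfun_datumOfRecord₁₃SepCoPH_eq_betaOfRecord₈Tχ`, `rfl`, and the definition of `betaOfRecord₈Tχ`). [cite: Balaban1987RG1, (1.20)–(1.22) p.264] -/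
theorem betaContH_merged_of_readOutAt_n22 (θ : Stage13HParams F N) (hP : θ.Provisos₁₃SepCoPH F N) {u : U3Carriers} (hγ : u.γ = θ.γ)
    (hD4 : ReadOutAt (datumOfRecord₁₃SepCoPH F N θ hP) u) (h22 : N22At u) :
    letI := θ.instVβ₁; letI := θ.instVβ₂; letI := θ.instιβ
    BetaContH θ.γ
      (betaOfMerged (betaMerged F (mergedTermFamilyMatT F N (TcanOfRecord F N) (chiFixed29 F N θ.ν θ.ε₂₉) θ.εbg) θ.ρ8 θ.bV)
        (beta0OfMerged (betaMerged F (mergedTermFamilyMatT F N (TcanOfRecord F N) (chiFixed29 F N θ.ν θ.ε₂₉) θ.εbg) θ.ρ8 θ.bV) θ.v₀) θ.γ) := by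
  have h := betaContH_of_readOutAt_n22 _ hD4 h22
  rw [βfun_datumOfRecord₁₃SepCoPH_eq_betaOfRecord₈Tχ, hγ] at h
  exact h

/-- ★★ **K2⁷ v3∕v4 LINE 2's STUB S3 `stub_cont13 : ContRecord13` — ITS BODY, LITERALLY (`N = 2`), FROM THE NODE-U3 SLOTS (D4) ∧ N22**: if at every
admissible ⁷ tuple SOME node-U3 bundle with window radius `θ.γ` carries the β-read-out binders on the datum of record and N22 (NE9 ∧ fading memory),
then the record's β is continuous on every box `]0, θ.γ]^{k+1}` — K2⁷'s `ContRecord13` text by delta.  So S3 is served by the SAME producer set that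
serves K3⁷'s `PHolderD4` (its (D4) and N22 rows), exactly as `stub_n17AtRecord13` is served by (D4) ∧ N18; the guard-free ∀ here is K2's own keying.
Nothing of Bałaban's is asserted: the antecedent is a HYPOTHESIS. [bookkeeping] -/
theorem contRecord13Body_of_readOut_n22
    (h : ∀ (F : T4Family) (θ : Stage13HParams F 2) (hP : θ.Provisos₁₃SepCoPH F 2), θ.Admissible F 2 →
      ∃ u : U3Carriers, u.γ = θ.γ ∧ ReadOutAt (datumOfRecord₁₃SepCoPH F 2 θ hP) u ∧ N22At u) :
    ∀ (F : T4Family) (θ : Stage13HParams F 2) (hP : θ.Provisos₁₃SepCoPH F 2), θ.Admissible F 2 →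
      letI := θ.instVβ₁; letI := θ.instVβ₂; letI := θ.instιβ
      BetaContH θ.γ
        (betaOfMerged (betaMerged F (mergedTermFamilyMatT F 2 (TcanOfRecord F 2) (chiFixed29 F 2 θ.ν θ.ε₂₉) θ.εbg) θ.ρ8 θ.bV)
          (beta0OfMerged (betaMerged F (mergedTermFamilyMatT F 2 (TcanOfRecord F 2) (chiFixed29 F 2 θ.ν θ.ε₂₉) θ.εbg) θ.ρ8 θ.bV) θ.v₀) θ.γ) := by
  intro F θ hP hθ
  obtain ⟨u, hγ, hD4, h22⟩ := h F θ hP hθ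
  exact betaContH_merged_of_readOutAt_n22 θ hP hγ hD4 h22

/-- ★ **ONE NODE-U3 WITNESS SERVES BOTH K3⁷-DERIVED STUBS OF K2⁷ LINE 2** (`N = 2`): if at every admissible ⁷ tuple SOME bundle `u` carries the junction
letters `u.γ = θ.γ`, `0 ≤ u.ρ < 1` and the three node-U3 slots (D4), N18, N22, then BOTH the body of `stub_n17AtRecord13 : N17AtRecord13` (dag-n17-a
`YMDAG.N17.n17At_of_readOutAt`, N22 idle) AND the body of `stub_cont13 : ContRecord13` (§2, N18 idle) hold.  LOCATED: line 2's K2-proper content is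
`stub_d1ResiduePos13 ∧ stub_anchor13`. [bookkeeping] -/
theorem n17Body_and_contBody_of_readOut_n18_n22
    (h : ∀ (F : T4Family) (θ : Stage13HParams F 2) (hP : θ.Provisos₁₃SepCoPH F 2), θ.Admissible F 2 →
      ∃ u : U3Carriers, u.γ = θ.γ ∧ 0 ≤ u.ρ ∧ u.ρ < 1 ∧ ReadOutAt (datumOfRecord₁₃SepCoPH F 2 θ hP) u ∧ N18At u ∧ N22At u) :
    (∀ (F : T4Family) (θ : Stage13HParams F 2) (hP : θ.Provisos₁₃SepCoPH F 2), θ.Admissible F 2 →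
        ∃ u : U3Carriers, u.γ = θ.γ ∧ 0 ≤ u.ρ ∧ u.ρ < 1 ∧ N17At (datumOfRecord₁₃SepCoPH F 2 θ hP) u) ∧
      ∀ (F : T4Family) (θ : Stage13HParams F 2) (hP : θ.Provisos₁₃SepCoPH F 2), θ.Admissible F 2 →
        letI := θ.instVβ₁; letI := θ.instVβ₂; letI := θ.instιβ
        BetaContH θ.γ
          (betaOfMerged (betaMerged F (mergedTermFamilyMatT F 2 (TcanOfRecord F 2) (chiFixed29 F 2 θ.ν θ.ε₂₉) θ.εbg) θ.ρ8 θ.bV)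
            (beta0OfMerged (betaMerged F (mergedTermFamilyMatT F 2 (TcanOfRecord F 2) (chiFixed29 F 2 θ.ν θ.ε₂₉) θ.εbg) θ.ρ8 θ.bV) θ.v₀) θ.γ) := by
  refine ⟨fun F θ hP hθ => ?_, contRecord13Body_of_readOut_n22 fun F θ hP hθ => ?_⟩
  · obtain ⟨u, hγ, hρ0, hρ1, hD4, h18, -⟩ := h F θ hP hθ
    exact ⟨u, hγ, hρ0, hρ1, YMDAG.N17.n17At_of_readOutAt _ hD4 h18⟩
  · obtain ⟨u, hγ, -, -, hD4, -, h22⟩ := h F θ hP hθ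
    exact ⟨u, hγ, hD4, h22⟩

/-! ### §2b Node N26's literal (binder B4 «β-continuity on SOME box») at the ⁷ record from the same two slots -/

/-- **NODE N26's LITERAL AT ANY DATUM ⇐ (D4) ∧ N22 on a bundle with a positive window radius**: `∃ γc > 0, BetaContH γc D.βfun` (binder B4's shape, as
read by dag-n26-a's `n26_of_histLipschitz` from node U2's currency) — here produced from node U3's slots.  N26 NOT discharged (hypotheses). [folklore] -/
theorem n26lit_of_readOutAt_n22 (D : Datum F N) {u : U3Carriers} (hγ : 0 < u.γ) (hD4 : ReadOutAt D u) (h22 : N22At u) :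
    ∃ γc : ℝ, 0 < γc ∧ BetaContH γc D.βfun :=
  ⟨u.γ, hγ, betaContH_of_readOutAt_n22 D hD4 h22⟩

/-- **NODE N26's LITERAL AT THE ⁷ ITEM DATUM ⇐ (D4) ∧ N22 at a bundle with `u.γ = θ.γ`, θ admissible** (`0 < θ.γ` by `Stage9Params.Admissible.gamma_pos`
through the parent views; the conclusion is dag-n26-c's adapter shape `∃ γc > 0, BetaContH γc (datumOfRecord₁₃SepCoPH F N θ hP).βfun`).  So the DAG node N26
(B4) at the record has, besides its (D4)-CHAIN road (dag-n26-a `…N26BetaContRecord` §3), the node-U2 road through (D4) ∧ N22 — both (D4)-dependent.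
N26 NOT discharged. [bookkeeping] -/
theorem n26lit_datumOfRecord₁₃SepCoPH_of_readOutAt_n22 (θ : Stage13HParams F N) (hP : θ.Provisos₁₃SepCoPH F N) (hθ : θ.Admissible F N)
    {u : U3Carriers} (hγ : u.γ = θ.γ) (hD4 : ReadOutAt (datumOfRecord₁₃SepCoPH F N θ hP) u) (h22 : N22At u) :
    ∃ γc : ℝ, 0 < γc ∧ BetaContH γc (datumOfRecord₁₃SepCoPH F N θ hP).βfun := by
  refine n26lit_of_readOutAt_n22 _ ?_ hD4 h22
  rw [hγ]
  exact hθ.toStage12.toStage9.gamma_pos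

end Record

/-! ## §3 JUNCTION WITH K3⁷ v3's STUB 1: the GUARDED restriction of S3 from the keyed rates predicate at the bundle of record -/

section Junction

/-- **K3⁷ v3's `KeyedRatesHolderD4 β (rrOfRecord 𝔯 ksel)` (body SPELLED at the bundle of record `rateCarriersOfRecord₁₃CoPH 𝔯 F θ hP g₀ os (ksel …)`,
under ANY tuple guard `Rg` — the skeleton's is `θ.ZhUnity F 2 ∧ θ.SlotsNondegenerate₁₃ F 2`) ⇒ β-CONTINUITY ON THE RECORD's BOXES AT EVERY `Rg`-ADMISSIBLE
⁷ TUPLE.**  The bundle's window radius IS `θ.γ` (`u3OfRecord₁₃_γ`, `rfl`), so §2 applies at `g₀ := 0`, `os := []`.  HONEST: this serves K2⁷'s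
`stub_cont13` ONLY on the `Rg` tuples; the guard-free remainder is K2's own (cf. dag-n17-w1's §3 for `stub_n17AtRecord13`). [bookkeeping] -/
theorem betaContH_guarded_of_keyedRatesHolderD4_ofRecord (Rg : (F : T4Family) → Stage13HParams F N → Prop) (𝔯 : RateReading₁₃CoPH N)
    (ksel : (F : T4Family) → (θ : Stage13HParams F N) → θ.Provisos₁₃CoPH F N → (ℕ → ℝ) → List (ULoop F) → ℕ) {β : ℝ}
    (h : ∀ (F : T4Family) (θ : Stage13HParams F N) (hP : θ.Provisos₁₃CoPH F N), Rg F θ → θ.Admissible F N →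
      ∀ (g₀ : ℕ → ℝ) (os : List (ULoop F)),
        RatesHolderAt (datumOfRecord₁₃CoPH F N θ hP) (rateCarriersOfRecord₁₃CoPH 𝔯 F θ hP g₀ os (ksel F θ hP g₀ os)) β ∧
        ReadOutAt (datumOfRecord₁₃CoPH F N θ hP) (rateCarriersOfRecord₁₃CoPH 𝔯 F θ hP g₀ os (ksel F θ hP g₀ os)).u3 ∧
        (0 ≤ (rateCarriersOfRecord₁₃CoPH 𝔯 F θ hP g₀ os (ksel F θ hP g₀ os)).u3.ρ ∧
          (rateCarriersOfRecord₁₃CoPH 𝔯 F θ hP g₀ os (ksel F θ hP g₀ os)).u3.ρ < 1)) :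
    ∀ (F : T4Family) (θ : Stage13HParams F N) (hP : θ.Provisos₁₃SepCoPH F N), Rg F θ → θ.Admissible F N →
      BetaContH θ.γ (betaOfRecord₁₃ F N θ.toStage13Params) := by
  intro F θ hP hG hθ
  have hk := h F θ hP.toCore hG hθ (fun _ => 0) []
  exact betaContH_betaOfRecord₁₃_of_readOutAt_n22_coPH θ hP.toCore rfl hk.2.1 hk.1.2.2.2.2.2

/-- **… AT `N = 2`, IN THE K2⁷ SKELETON's MERGED CURRENCY**: under the skeleton's guard `θ.ZhUnity F 2 ∧ θ.SlotsNondegenerate₁₃ F 2`, K3⁷ v3's keyed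
rates body at the bundle of record gives the `ContRecord13` conclusion at every GUARDED admissible ⁷ tuple (the guard displayed as an extra hypothesis of
the ∀ — S3's own ∀ is guard-free). [bookkeeping] -/
theorem contRecord13Body_guarded_of_keyedRatesHolderD4_ofRecord (𝔯 : RateReading₁₃CoPH 2)
    (ksel : (F : T4Family) → (θ : Stage13HParams F 2) → θ.Provisos₁₃CoPH F 2 → (ℕ → ℝ) → List (ULoop F) → ℕ) {β : ℝ}
    (h : ∀ (F : T4Family) (θ : Stage13HParams F 2) (hP : θ.Provisos₁₃CoPH F 2), (θ.ZhUnity F 2 ∧ θ.SlotsNondegenerate₁₃ F 2) → θ.Admissible F 2 →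
      ∀ (g₀ : ℕ → ℝ) (os : List (ULoop F)),
        RatesHolderAt (datumOfRecord₁₃CoPH F 2 θ hP) (rateCarriersOfRecord₁₃CoPH 𝔯 F θ hP g₀ os (ksel F θ hP g₀ os)) β ∧
        ReadOutAt (datumOfRecord₁₃CoPH F 2 θ hP) (rateCarriersOfRecord₁₃CoPH 𝔯 F θ hP g₀ os (ksel F θ hP g₀ os)).u3 ∧
        (0 ≤ (rateCarriersOfRecord₁₃CoPH 𝔯 F θ hP g₀ os (ksel F θ hP g₀ os)).u3.ρ ∧
          (rateCarriersOfRecord₁₃CoPH 𝔯 F θ hP g₀ os (ksel F θ hP g₀ os)).u3.ρ < 1)) :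
    ∀ (F : T4Family) (θ : Stage13HParams F 2) (hP : θ.Provisos₁₃SepCoPH F 2), (θ.ZhUnity F 2 ∧ θ.SlotsNondegenerate₁₃ F 2) → θ.Admissible F 2 →
      letI := θ.instVβ₁; letI := θ.instVβ₂; letI := θ.instιβ
      BetaContH θ.γ
        (betaOfMerged (betaMerged F (mergedTermFamilyMatT F 2 (TcanOfRecord F 2) (chiFixed29 F 2 θ.ν θ.ε₂₉) θ.εbg) θ.ρ8 θ.bV)
          (beta0OfMerged (betaMerged F (mergedTermFamilyMatT F 2 (TcanOfRecord F 2) (chiFixed29 F 2 θ.ν θ.ε₂₉) θ.εbg) θ.ρ8 θ.bV) θ.v₀) θ.γ) := by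
  intro F θ hP hG hθ
  have hk := h F θ hP.toCore hG hθ (fun _ => 0) []
  exact betaContH_merged_of_readOutAt_n22 θ hP rfl hk.2.1 hk.1.2.2.2.2.2

end Junction

/-! ## §4 UNDER K3⁷ v3's NODE-U3 PIN: S3 in KERNEL currency — (5.10) of record + windowed NE9 of the kernel functional of record; no N18 -/

section Kernels

variable {F : T4Family}

/-- ★ **β-CONTINUITY OF THE RECORD's β FROM THE KERNEL OBJECTS OF RECORD** (node00-def-W1's `U3OfKernels.objectsOfRecord₁₃`, W1-19): for a letter block
`ℓ` with its signs, `0 < ℓ.κ`, the read-out domination `betaPrime510 4 1 ℓ.κ ≤ ℓ.cr`, the (5.10) clause of record `KernelDecayOfRecord₁₃ F N θ 0 1 ℓ.κ`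
(⇒ (D4) at the level-0 bundle, dag-n27-w1 `readOutAt_objectsOfRecord₁₃_coPH`) and NE9 of the KERNEL FUNCTIONAL OF RECORD on the window (⇔ N22 at that
bundle, dag-n22-w3 `n22At_u3OfRecord₁₃_objectsOfRecord₁₃_iff`): `BetaContH θ.γ (betaOfRecord₁₃ F N θ.toStage13Params)`.  NO N18 ∕ NE5 input.  A REDUCTION,
not a discharge: (5.10) for the limiting (1.21) kernels of the merged term of record and NE9 there are HYPOTHESES. [cite: Balaban1987RG1, (5.10) p.293 and §5 p.298] -/
theorem betaContH_betaOfRecord₁₃_of_kernels (θ : Stage13HParams F N) (hP : θ.Provisos₁₃CoPH F N) (ℓ : U3Letters₁₁) (hs : ℓ.Signs) (hκ : 0 < ℓ.κ)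
    (hcr : betaPrime510 4 1 ℓ.κ ≤ ℓ.cr) (hdec : KernelDecayOfRecord₁₃ F N θ.toStage13Params 0 1 ℓ.κ)
    (h9 : NE9 ((objectsOfRecord₁₃ F N θ.toStage13Params ℓ).EA 0) (Window θ.γ) ℓ.κ ℓ.moduli) :
    BetaContH θ.γ (betaOfRecord₁₃ F N θ.toStage13Params) :=
  betaContH_betaOfRecord₁₃_of_readOutAt_n22_coPH θ hP rfl (readOutAt_objectsOfRecord₁₃_coPH θ hP ℓ hs hκ hcr 0 hdec)
    ((n22At_u3OfRecord₁₃_objectsOfRecord₁₃_iff F N θ.toStage13Params ℓ hs 0).2 h9)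

/-- **THE `hpin` FORM** (K3⁷ v3's `U3PinnedKernels 𝔯 ℓ` VERBATIM: `(𝔯.lit F θ hP g₀ os).u3 = objectsOfRecord₁₃ F N θ.toStage13Params ℓ`), N22 TAKEN AT
THE PINNED BUNDLE OF RECORD as stub 1's `RatesHolderAt` delivers it: with the (5.10) clause and the letter rows, `BetaContH θ.γ (betaOfRecord₁₃ …)` —
at whatever run length `k` the selector reads. [bookkeeping] -/
theorem betaContH_of_kernels_pin_n22At (𝔯 : RateReading₁₃CoPH N) (θ : Stage13HParams F N) (hP : θ.Provisos₁₃CoPH F N) (g₀ : ℕ → ℝ)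
    (os : List (ULoop F)) (ℓ : U3Letters₁₁) (hs : ℓ.Signs) (hpin : (𝔯.lit F θ hP g₀ os).u3 = objectsOfRecord₁₃ F N θ.toStage13Params ℓ)
    (hκ : 0 < ℓ.κ) (hcr : betaPrime510 4 1 ℓ.κ ≤ ℓ.cr) (hdec : KernelDecayOfRecord₁₃ F N θ.toStage13Params 0 1 ℓ.κ) (k : ℕ)
    (h22 : N22At (rateCarriersOfRecord₁₃CoPH 𝔯 F θ hP g₀ os k).u3) : BetaContH θ.γ (betaOfRecord₁₃ F N θ.toStage13Params) := by
  have hD4 : ReadOutAt (datumOfRecord₁₃CoPH F N θ hP) (rateCarriersOfRecord₁₃CoPH 𝔯 F θ hP g₀ os k).u3 := by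
    show ReadOutAt (datumOfRecord₁₃CoPH F N θ hP) (u3OfRecord₁₃ θ.toStage13Params (𝔯.lit F θ hP g₀ os).u3 k)
    rw [hpin]
    exact readOutAt_objectsOfRecord₁₃_coPH θ hP ℓ hs hκ hcr k hdec
  exact betaContH_betaOfRecord₁₃_of_readOutAt_n22_coPH θ hP rfl hD4 h22

/-- **S3 UNDER A LETTER READING `ℓ`, `N = 2`, K2⁷'s TEXT LITERALLY**: if at every admissible ⁷ tuple the letter block `ℓ F θ` has its signs, `0 < κ`,
`betaPrime510 4 1 κ ≤ cr`, the (5.10) clause of record and NE9 of the kernel functional of record on the window, then `ContRecord13`'s body holds — S3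
costs EXACTLY the (D4) + N22 rows of K3⁷ v3 stub 1's bill in kernel currency, nothing else.  HYPOTHESES throughout; nothing discharged. [bookkeeping] -/
theorem contRecord13Body_of_kernels (ℓ : (F : T4Family) → Stage13HParams F 2 → U3Letters₁₁)
    (h : ∀ (F : T4Family) (θ : Stage13HParams F 2) (hP : θ.Provisos₁₃SepCoPH F 2), θ.Admissible F 2 →
      (ℓ F θ).Signs ∧ 0 < (ℓ F θ).κ ∧ betaPrime510 4 1 (ℓ F θ).κ ≤ (ℓ F θ).cr ∧ KernelDecayOfRecord₁₃ F 2 θ.toStage13Params 0 1 (ℓ F θ).κ ∧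
        NE9 ((objectsOfRecord₁₃ F 2 θ.toStage13Params (ℓ F θ)).EA 0) (Window θ.γ) (ℓ F θ).κ (ℓ F θ).moduli) :
    ∀ (F : T4Family) (θ : Stage13HParams F 2) (hP : θ.Provisos₁₃SepCoPH F 2), θ.Admissible F 2 →
      letI := θ.instVβ₁; letI := θ.instVβ₂; letI := θ.instιβ
      BetaContH θ.γ
        (betaOfMerged (betaMerged F (mergedTermFamilyMatT F 2 (TcanOfRecord F 2) (chiFixed29 F 2 θ.ν θ.ε₂₉) θ.εbg) θ.ρ8 θ.bV)
          (beta0OfMerged (betaMerged F (mergedTermFamilyMatT F 2 (TcanOfRecord F 2) (chiFixed29 F 2 θ.ν θ.ε₂₉) θ.εbg) θ.ρ8 θ.bV) θ.v₀) θ.γ) := by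
  intro F θ hP hθ
  obtain ⟨hs, hκ, hcr, hdec, h9⟩ := h F θ hP hθ
  have hD4 : ReadOutAt (datumOfRecord₁₃SepCoPH F 2 θ hP) (u3OfRecord₁₃ θ.toStage13Params (objectsOfRecord₁₃ F 2 θ.toStage13Params (ℓ F θ)) 0) := by
    rw [datumOfRecord₁₃SepCoPH_eq_coPH]
    exact readOutAt_objectsOfRecord₁₃_coPH θ hP.toCore (ℓ F θ) hs hκ hcr 0 hdec
  exact betaContH_merged_of_readOutAt_n22 θ hP rfl hD4 ((n22At_u3OfRecord₁₃_objectsOfRecord₁₃_iff F 2 θ.toStage13Params (ℓ F θ) hs 0).2 h9)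

end Kernels

end YMDAG.N17.HistModuliCont

end
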